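import Literature.MathematicalPhysics.QuantumFieldTheory.Balaban1983to89.Node00.CarriersB13CondTower
import Literature.MathematicalPhysics.QuantumFieldTheory.Balaban1983to89.B13ConditionedWitness

/-!
# NODE 00 (YM-PLAN Track A) — STAGE 3′(X.B13): A NON-DEGENERATE INHABITANT OF THE CONDITIONED TOWER's RUNG FACE
# (`ResidB13.hopCond`: over ANY g0 layer, on ANY site torus, the conditioned datum whose operator is the symmetric nearest-neighbour hopping model
# `1 + F(σ,u) + F(σ,u)ᵀ` between TWO located copies of the sites; S5's `termWalksRef_toK` FIRES at it with ONE explicit admissible reference package)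

COMPANION MODULE of `Node00/CarriersB13CondTower` (storey S5, p582159; seat `pub-ymgap-dag-n10-w3` g0, director-ym LINE №197 ∕ HUMAN RULING D-0149),
answering the discharge referee's A2∕A6 note on that storey (ref-M READ-1: *"a NON-degenerate inhabitant (X ≠ ∅, Y0l ∩ Pl = ∅, an operator with
`JointWalkExpansion` + positivity) is NOT exhibited"*).  APPEND-ONLY DISCIPLINE: a NEW importing module; S5, n10-c's module 22 `B13ConditionedWitness`
and n10-b's `NodeOLettersOfWalksWitness(Sym)` are untouched and CONSUMED BY NAME.
[Balaban1988RG2Cluster] = T. Bałaban, *Renormalization group approach to lattice gauge field theories. II. Cluster expansions*, Commun. Math. Phys.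
**116** (1988) 1–22, (1.11) p. 5, p. 13, (2.5)–(2.7) pp. 12–13, p. 15 (*"For the pair (U, 0) the operators are symmetric, and the measure is
positive"*), (2.16) p. 16; [13] = [Balaban1985BackgroundPropagators] Thm 3.10 (3.107)–(3.108) p. 416, Thm 3.12 p. 423.

WHAT (MODEL — honesty ∕ non-vacuity only).  Over ANY g0 layer `lam : ResidB13 θ` and ANY site torus `UT Nf` ([13]), the conditioned datum
`ResidB13.hopCond lam Nf : ResidB13C θ` has, per term: interior AND exterior bonds BOTH a located copy of the sites (`Λ = C₀ := UT Nf`, `locN :=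
Sum.elim id id` — a GENUINE off-diagonal block), the operator `KK := massLocal 1 (symmetrize F)`, `F := hopTerms inl inr 1 ℓ univ 0` = `1 + F(σ,u) +
F(σ,u)ᵀ` (n10-b ∕ n10-c's symmetric nearest-neighbour hopping `inl z → inr (z + e_k)` between the copies, coefficient `1 + ℓ(u)` with `ℓ = id : ℂ →L[ℂ] ℂ`
— genuine `u`-dependence —, s-monomial `σ₀` on EVERY term — genuine `σ`-dependence; [13] (3.107): the reversed walk carries the transposed term), real
reference `K₀ := 1` (positive definite), σ-region `X := univ ≠ ∅`, χ-bond sets `Y0l := ∅`, `Pl := ∅` (NO row bond in `Y0l ∩ Pl` — S4's lever does NOT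
fire), `uOf := 0`, `r := 1`, trivial `emb`.

WHAT IS PROVED (0 sorry).  §1 the model reference package `rfHop c ν` (`R = 1`, drops `2`, rates `1`, `K̄ = 1 + K̄_loc`, `m₀ = m_{A,0} = 1`, `η = 1`,
`R_σ = 0`, `n_B = 2`, `d_m = ν`) and `rfHop_admissible`; the END-site fibre bound `card_filter_up_le` of the hopping family (`w ↦ w + e_k` injective).
§2 `ResidB13.hopCond`, faces `hopCond_toK_frame` (`rfl`), `hopCond_X` ∕ `hopCond_X_nonempty`, `hopCond_Y0l ∕ hopCond_Pl ∕ hopCond_Y0l_inter_Pl` (= ∅),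
★ `hopCond_KK_sub_zero` (NON-DEGENERACY: `KK σ u − KK 0 u₀ = F(σ,u) + F(σ,u)ᵀ`, module 22's `massLocal_symmetrize_sub_zero`), ★★ **`termWalksRef_hopCond`**:
`TermWalksRef ((lam.hopCond Nf).toK.𝒦 Z t) (rfHop …)` for EVERY term `(Z, t)` whenever `0 ≤ κ₁` — S5's §2 face at a non-degenerate datum, by module 22's
`termWalksRef_condKernels_massLocal_symmetrize` over n10-b's `hopTerms_isLocal`; `exists_residB13C_termWalksRef` (the ∃-form over any g0 layer: frame kept,
`X ≠ ∅`, `Y0l ∩ Pl = ∅`, the rung at `rfHop`).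

HONEST FRAMING: a finite-matrix MODEL on [13]'s site torus certifying that S5's conditioned-tower datum TOGETHER WITH its rung face is inhabited
NON-degenerately, torus-uniformly (the constants of `rfHop` do not read the torus) — and NOTHING ELSE: whether Bałaban's `C\*Δ_k(σ,𝐔,𝐉)C` carries such an
expansion with k-uniform constants at complex backgrounds is NODE A ([13] Thms 3.10 ∕ 3.12; node N06 s4 ∕ row (D4)); the Lemma 1–2 located inputs, the
numerics and the junctions' other binders have their own witnesses (n10-b `B13ChainJointNonvacuity`, n10-w1 ∕ n10-w2's W-WAVE-2 files).  Count-neutral; N10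
NOT discharged; K1⁷ NOT closed; counts of record unmoved; one finite 𝕋⁴ programme at fixed ε, Bałaban AS PRINTED — the Yang–Mills mass gap (Clay) is NOT
proved by any of this; R4 closes the conditional finite-𝕋⁴ rung `BalabanLadder.UV` only; nothing continuum ∕ ℝ⁴ ∕ OS.  No `sorry`, no `axiom`, no
`instance` declaration, no `notation`.
-/

noncomputable section

namespace Literature.MathematicalPhysics.QuantumFieldTheory.Balaban1983to89.Node00

open scoped Matrix
open Literature.MathematicalPhysics.QuantumFieldTheory.Balaban1983to89.TreeLengthTorus (TDom TPt)
open Literature.MathematicalPhysics.QuantumFieldTheory.Balaban1983to89.B13Lemma3TorusTerms (terms)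
open Literature.MathematicalPhysics.QuantumFieldTheory.Balaban1983to89.B5TorusCover (UT)
open Literature.MathematicalPhysics.QuantumFieldTheory.Balaban1983to89.B9Thm37GlueTorus (tdist1 tdist1_nonneg)
open Literature.MathematicalPhysics.QuantumFieldTheory.Balaban1983to89.B5Leibniz121 (up dn up_dn)
open Literature.MathematicalPhysics.QuantumFieldTheory.Balaban1983to89.NodeOLettersOfWalksPerturbative (RefPackage TermWalksRef)
open Literature.MathematicalPhysics.QuantumFieldTheory.Balaban1983to89.NodeOLettersOfWalksWitness (massLocal kbarLoc kbarLoc_nonneg hopTerms hopTerms_isLocal)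
open Literature.MathematicalPhysics.QuantumFieldTheory.Balaban1983to89.B13ConditionedWitness
  (symmetrize massLocal_symmetrize_zero massLocal_symmetrize_sub_zero termWalksRef_condKernels_massLocal_symmetrize)

/-! ## §1. The model reference package and the END-site fibre bound of the hopping family -/

section Package

/-- MODEL. **The reference package of the hopping witness**: `R = 1`, drops `ε_L = ε_P = ε_A = 2`, rates `κ_L = κ_P = κ_A = 1`, constants
`K̄ = 1 + K̄_loc(c; λ′ = |1|(1 + ‖id‖·1), r = 1, ρ = 1 + 3, n_B = ν + ν)` (n10-b's `kbarLoc`), reference positivities `m₀ = m_{A,0} = 1` (the mass), volume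
rate `η = 1`, `R_σ = 0`, multiplicity `n_B = 2` (two copies of each site), dimension `ν`.  Free of the torus periods. [cite: Balaban1988RG2Cluster, p.15, (2.16) p.16] -/
def rfHop (c : B13.Consts) (ν : ℕ) : RefPackage where
  R := 1
  εL := 2
  kapL := 1
  KbarL := 1 + kbarLoc c (|(1 : ℝ)| * (1 + ‖ContinuousLinearMap.id ℂ ℂ‖ * 1)) 1 (1 + 3) (ν + ν) ν
  εP := 2
  kapP := 1
  KbarP := 1 + kbarLoc c (|(1 : ℝ)| * (1 + ‖ContinuousLinearMap.id ℂ ℂ‖ * 1)) 1 (1 + 3) (ν + ν) ν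
  m₀ := 1
  εA := 2
  kapA := 1
  KbarA := 1 + kbarLoc c (|(1 : ℝ)| * (1 + ‖ContinuousLinearMap.id ℂ ℂ‖ * 1)) 1 (1 + 3) (ν + ν) ν
  mA₀ := 1
  η := 1
  Rσ := 0
  nB := 2
  dm := ν

/-- The hopping coefficient bound `|1|(1 + ‖id‖·1)` is non-negative. [folklore] -/
private theorem coefBound_nonneg : 0 ≤ |(1 : ℝ)| * (1 + ‖ContinuousLinearMap.id ℂ ℂ‖ * 1) := by positivity

/-- The model package is ADMISSIBLE (all signs; `η = 1 ≤ κ_A = 1`). [cite: Balaban1988RG2Cluster, p.15, (2.16) p.16] -/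
theorem rfHop_admissible (c : B13.Consts) (ν : ℕ) : (rfHop c ν).Admissible where
  hR := one_pos
  hεL := by norm_num [rfHop]
  hkapL := by norm_num [rfHop]
  hKbarL := add_nonneg zero_le_one (kbarLoc_nonneg c coefBound_nonneg _ _ _ _)
  hεP := by norm_num [rfHop]
  hkapP := by norm_num [rfHop]
  hKbarP := add_nonneg zero_le_one (kbarLoc_nonneg c coefBound_nonneg _ _ _ _)
  hm₀ := by norm_num [rfHop]
  hεA := by norm_num [rfHop]
  hkapA := by norm_num [rfHop]
  hKbarA := add_nonneg zero_le_one (kbarLoc_nonneg c coefBound_nonneg _ _ _ _)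
  hmA₀ := by norm_num [rfHop]
  hη := by norm_num [rfHop]
  hηA := by norm_num [rfHop]

variable {ν : ℕ} {Nf : Fin ν → ℕ} [∀ i, NeZero (Nf i)]

/-- `(x + e_μ) − e_μ = x` on the torus carrier (companion of `B5Leibniz121.up_dn`). [folklore] -/
private theorem dn_up' (x : UT Nf) (μ : Fin ν) : dn (up x μ) μ = x := by
  unfold up dn
  have h1 : UT.toSite Nf (UT.ofSite Nf (Function.update (UT.toSite Nf x) μ (UT.toSite Nf x μ + 1))) μ
      = UT.toSite Nf x μ + 1 := by
    show Function.update (UT.toSite Nf x) μ (UT.toSite Nf x μ + 1) μ = _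
    rw [Function.update_self]
  rw [h1, add_sub_cancel_right]
  show UT.ofSite Nf (Function.update (Function.update (UT.toSite Nf x) μ (UT.toSite Nf x μ + 1)) μ
    (UT.toSite Nf x μ)) = x
  rw [Function.update_idem, Function.update_eq_self]
  rfl

/-- **The END-site fibre bound of the nearest-neighbour hopping family**: at most `ν` bonds `(w, k)` end at a given site (`w ↦ w + e_k` is injective
for each direction `k`). [cite: Balaban1985BackgroundPropagators, (3.107) p.416 (bookkeeping: multiplicity of one-step walks)] -/
theorem card_filter_up_le (z : UT Nf) : (Finset.univ.filter fun b : UT Nf × Fin ν => up b.1 b.2 = z).card ≤ ν := by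
  classical
  calc (Finset.univ.filter fun b : UT Nf × Fin ν => up b.1 b.2 = z).card
      ≤ (Finset.univ : Finset (Fin ν)).card := by
        refine Finset.card_le_card_of_injOn (fun b => b.2) (fun _ _ => Finset.mem_coe.2 (Finset.mem_univ _)) ?_
        intro b hb b' hb' h
        simp only [Finset.coe_filter, Set.mem_setOf_eq, Finset.mem_univ, true_and] at hb hb'
        have h2 : b.2 = b'.2 := h
        have h1 : b.1 = b'.1 := by
          have e := congrArg (fun w => dn w b.2) (hb.trans hb'.symm)
          simp only [dn_up'] at e
          rw [h2] at e
          simpa only [dn_up'] using e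
        exact Prod.ext h1 h2
    _ = ν := by simp

end Package

/-! ## §2. The hopping datum over a g0 layer and the rung at it -/

section Hop

variable {θ : Stage3Params}
variable {ν : ℕ} (Nf : Fin ν → ℕ) [∀ i, NeZero (Nf i)]

/-- MODEL. The forward nearest-neighbour hopping family from the INTERIOR copy to the EXTERIOR copy of the sites, coefficient `1·(1 + u)`
(`ℓ = id`), s-monomial `σ₀` on every term (σ-region `univ`). [cite: Balaban1988RG2Cluster, (1.11) p.5, p.13; Balaban1985BackgroundPropagators, (3.107) p.416] -/
abbrev hopF (n : ℕ) : B13LocalKernelWalks.LocalTerms 4 (n + 1) ν Nf (UT Nf ⊕ UT Nf) (UT Nf ⊕ UT Nf) ℂ :=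
  hopTerms (d := 4) (N' := n + 1) Nf (Sum.inl : UT Nf → UT Nf ⊕ UT Nf) (Sum.inr : UT Nf → UT Nf ⊕ UT Nf) 1
    (ContinuousLinearMap.id ℂ ℂ) Finset.univ (fun _ => 0)

/-- Every term of the forward family carries the parameter `σ₀` (its base site lies in the σ-region `univ`). [cite: Balaban1988RG2Cluster, (1.11) p.5, p.13] -/
theorem hopF_J_nonempty (n : ℕ) : ∀ b, ((hopF Nf n).J b).Nonempty := by
  intro b
  simp only [Finset.mem_univ, if_true]
  exact Finset.singleton_nonempty _

/-- **THE HOPPING CONDITIONED DATUM over a g0 layer** (MODEL): `Λ = C₀ :=` the sites, `locN := Sum.elim id id`, operator `1 + F(σ,u) + F(σ,u)ᵀ`, real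
reference `1`, `X := univ`, `Y0l = Pl := ∅`, `uOf := 0`, `r := 1`, trivial embedding. [cite: Balaban1988RG2Cluster, (2.5)–(2.7) pp.12–13, p.15, (1.11) p.5; Balaban1985BackgroundPropagators, (3.107) p.416] -/
def ResidB13.hopCond (lam : ResidB13 θ) : ResidB13C θ :=
  lam.withCond ν Nf ℂ (fun _ _ => UT Nf) (fun _ _ => UT Nf)
    (fun _ _ => massLocal (d := 4) (N' := lam.n + 1) Nf 1 (symmetrize (hopF Nf lam.n)))
    (fun _ _ => Matrix.diagonal fun _ => (1 : ℝ))
    (fun _ _ => massLocal_symmetrize_zero Nf (hopF Nf lam.n) 1 (hopF_J_nonempty Nf lam.n) (0 : ℂ))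
    (fun _ _ => Matrix.posDef_diagonal_iff.2 fun _ => one_pos)
    (fun _ _ => Sum.elim id id) (fun _ _ => Finset.univ) (fun _ _ => Fintype.card (UT Nf))
    (fun _ _ _ => (Finset.card_filter_le _ _).trans Finset.card_univ.le)
    (fun _ _ _ => 0) 1 (fun _ _ => ∅) (fun _ _ => ∅) (fun _ _ φ _ => φ)

variable (lam : ResidB13 θ)

/-- The frame is the given layer (`rfl`). [cite: Balaban1988RG2Cluster, (2.14) p.15 (bookkeeping)] -/
theorem ResidB13.hopCond_toK_frame : (lam.hopCond Nf).toK.frame = { lam with T₃ := fun _ _ _ => 0 } := rfl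

/-- The σ-region of every term is the whole site torus (`rfl`). [cite: Balaban1988RG2Cluster, p.13 (bookkeeping)] -/
theorem ResidB13.hopCond_X (Z : TDom 4 (lam.n + 1)) (t : B13TermIdx θ lam.n lam.m₃) : (lam.hopCond Nf).X Z t = Finset.univ := rfl

/-- **`X ≠ ∅`**: the σ-region of every term is non-empty (the site torus has a point). [cite: Balaban1988RG2Cluster, p.13] -/
theorem ResidB13.hopCond_X_nonempty (Z : TDom 4 (lam.n + 1)) (t : B13TermIdx θ lam.n lam.m₃) : ((lam.hopCond Nf).X Z t).Nonempty :=
  ⟨UT.ofSite (N := Nf) fun _ => 0, Finset.mem_univ _⟩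

/-- No small-field row bond is declared (`rfl`). [cite: Balaban1988RG2Cluster, (2.3) p.12 (bookkeeping)] -/
theorem ResidB13.hopCond_Y0l (Z : TDom 4 (lam.n + 1)) (t : B13TermIdx θ lam.n lam.m₃) : (lam.hopCond Nf).Y0l Z t = ∅ := rfl

/-- No large-field row bond is declared (`rfl`). [cite: Balaban1988RG2Cluster, (2.3) p.12 (bookkeeping)] -/
theorem ResidB13.hopCond_Pl (Z : TDom 4 (lam.n + 1)) (t : B13TermIdx θ lam.n lam.m₃) : (lam.hopCond Nf).Pl Z t = ∅ := rfl

/-- **`Y0l ∩ Pl = ∅`**: S4's relocated lever (a row bond in `Y0l ∩ Pl` kills the term) does NOT fire at this datum. [cite: Balaban1988RG2Cluster, (2.3) p.12] -/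
theorem ResidB13.hopCond_Y0l_inter_Pl (Z : TDom 4 (lam.n + 1)) (t : B13TermIdx θ lam.n lam.m₃) :
    (lam.hopCond Nf).Y0l Z t ∩ (lam.hopCond Nf).Pl Z t = ∅ := rfl

/-- **NON-DEGENERACY**: the operator moves with `σ` and `u` exactly as `F(σ,u) + F(σ,u)ᵀ` — `KK σ u − KK 0 u₀ = F(σ,u) + F(σ,u)ᵀ`.
[cite: Balaban1988RG2Cluster, (1.11) p.5, p.13, p.15; Balaban1985BackgroundPropagators, (3.107) p.416] -/
theorem ResidB13.hopCond_KK_sub_zero (Z : TDom 4 (lam.n + 1)) (t : B13TermIdx θ lam.n lam.m₃) (σ : TPt 4 (lam.n + 1) → ℂ) (u u₀ : ℂ) :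
    (lam.hopCond Nf).KK Z t σ u - (lam.hopCond Nf).KK Z t 0 u₀ = (hopF Nf lam.n).kernel σ u + ((hopF Nf lam.n).kernel σ u)ᵀ :=
  massLocal_symmetrize_sub_zero Nf (hopF Nf lam.n) 1 (hopF_J_nonempty Nf lam.n) σ u u₀

omit [∀ i, NeZero (Nf i)] in
/-- The all-bonds multiplicity of `Sum.elim id id`: each site carries exactly its two copies. [folklore] -/
private theorem card_filter_elim_le (x : UT Nf) :
    (Finset.univ.filter fun k : UT Nf ⊕ UT Nf => Sum.elim id id k = x).card ≤ 2 := by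
  classical
  have hsub : (Finset.univ.filter fun k : UT Nf ⊕ UT Nf => Sum.elim id id k = x) ⊆ {Sum.inl x, Sum.inr x} := by
    intro k hk
    simp only [Finset.mem_filter, Finset.mem_univ, true_and] at hk
    rcases k with k | k
    · simp only [Sum.elim_inl, id_eq] at hk
      simp [hk]
    · simp only [Sum.elim_inr, id_eq] at hk
      simp [hk]
  refine (Finset.card_le_card hsub).trans ?_
  exact (Finset.card_insert_le _ _).trans (by simp)

/-- **S5's RUNG FACE FIRES AT THE HOPPING DATUM**: for every term `(Z, t)`, `TermWalksRef ((lam.hopCond Nf).toK.𝒦 Z t) (rfHop c′ ν)` with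
`c′ = {lam.c with L := θ.ℓ₆+1}` the constants the kernels are stated at — module 22's `termWalksRef_condKernels_massLocal_symmetrize` (ONE joint walk
expansion of `1 + F ⊕ Fᵀ` through `univ` with s-monomial terms and the reversal, ONE positivity `Re KK(0,0) ≥ 1`) over n10-b's `hopTerms_isLocal`, the
END-site fibre bound of §1, far-ness `0`, multiplicity `2`, dimension `ν`; needs only `0 ≤ κ₁`.
[cite: Balaban1988RG2Cluster, (2.5)–(2.7) pp.12–13, p.15, (2.16) p.16, (1.11) p.5; Balaban1985BackgroundPropagators, Thm 3.10 p.416, Thm 3.12 p.423] -/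
theorem termWalksRef_hopCond (hκ₁ : 0 ≤ lam.c.κ₁) (Z : TDom 4 (lam.n + 1)) (t : B13TermIdx θ lam.n lam.m₃) :
    -- `TermWalksRef ((lam.hopCond Nf).toK.𝒦 Z t) (rfHop c′ ν)` with the record's own `C₀`-instances passed explicitly (at a CONCRETE datum the
    -- instance binders of `TermWalksRef` do not resolve through the `def`; the ∃-form below states it plainly)
    @TermWalksRef _ _ _ _ _ _ _ _ _ ((lam.hopCond Nf).toK.𝒦 Z t) ((lam.hopCond Nf).toK.finC₀ Z t) ((lam.hopCond Nf).toK.decC₀ Z t)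
      (rfHop ({ lam.c with L := θ.ℓ₆ + 1 } : B13.Consts) ν) :=
  termWalksRef_condKernels_massLocal_symmetrize ({ lam.c with L := θ.ℓ₆ + 1 } : B13.Consts) hκ₁ (hopF Nf lam.n)
    (hopF_J_nonempty Nf lam.n) ⟨UT.ofSite (N := Nf) fun _ => 0, Finset.mem_univ _⟩
    (hopTerms_isLocal (d := 4) (N' := lam.n + 1) _ (er := Sum.inl) (ec := Sum.inr) (locp := Sum.elim id id)
      (locn := Sum.elim id id) (fun _ => rfl) (fun _ => rfl) 1 (ContinuousLinearMap.id ℂ ℂ) Finset.univ (fun _ => 0) 1)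
    (fun z => card_filter_up_le z) coefBound_nonneg one_pos zero_le_one (Fintype.card (UT Nf))
    (fun _ => (Finset.card_filter_le _ _).trans Finset.card_univ.le) (fun _ _ _ => tdist1_nonneg _ _)
    (fun x => card_filter_elim_le Nf x) le_rfl (rfHop _ ν) le_rfl le_rfl le_rfl le_rfl le_rfl le_rfl le_rfl le_rfl le_rfl le_rfl
    le_rfl le_rfl le_rfl le_rfl le_rfl

include Nf in
/-- **∃-FORM — THE CONDITIONED TOWER's RUNG FACE IS INHABITED NON-DEGENERATELY over every g0 layer with `0 ≤ κ₁`**: a conditioned datum with the given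
frame, non-empty σ-regions, no row bond in `Y0l ∩ Pl`, and the reference rung `TermWalksRef` of EVERY term at ONE admissible package.
[cite: Balaban1988RG2Cluster, (2.5)–(2.7) pp.12–13, p.15, (2.16) p.16; Balaban1985BackgroundPropagators, Thm 3.10 p.416, Thm 3.12 p.423] -/
theorem exists_residB13C_termWalksRef (hκ₁ : 0 ≤ lam.c.κ₁) :
    ∃ lamC : ResidB13C θ, ∃ rf : RefPackage, rf.Admissible ∧ lamC.toK.frame = { lam with T₃ := fun _ _ _ => 0 } ∧
      ∀ (Z : TDom 4 (lamC.n + 1)) (t : B13TermIdx θ lamC.n lamC.m₃),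
        (lamC.X Z t).Nonempty ∧ lamC.Y0l Z t ∩ lamC.Pl Z t = ∅ ∧ TermWalksRef (lamC.toK.𝒦 Z t) rf :=
  ⟨lam.hopCond Nf, rfHop _ ν, rfHop_admissible _ ν, lam.hopCond_toK_frame Nf, fun Z t =>
    ⟨lam.hopCond_X_nonempty Nf Z t, lam.hopCond_Y0l_inter_Pl Nf Z t, termWalksRef_hopCond Nf lam hκ₁ Z t⟩⟩

end Hop

end Literature.MathematicalPhysics.QuantumFieldTheory.Balaban1983to89.Node00

end
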